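import Summits.AtomisticToContinuum.HydrodynamicLimit.Theorems.InformationPercolationEnginePercolationClosesChaosForecastRetyped
import Summits.AtomisticToContinuum.HydrodynamicLimit.Theorems.InformationPercolationEnginePercolationClosesChaosCesaroStaticAssemblyFloor
import HarnessLib

/-!
# Local equilibrium S5 of the line `equilibrium-forecast-chain-rule` (crux `InformationPercolationEngine.PercolationClosesChaos`,
stmt-AtomisticToContinuum-15178) — the registered stub `stub_cesaroLocalEquilibrium` of skeleton v5 (lead c3, worker W4)

Closes the registered stub
`stub_cesaroLocalEquilibrium : MesoStaticMaxwellRarity → LocalCountUI → NoKineticIrregularity → CoarseLocalMaxwellianity`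
(local equilibrium of the EVOLVED law at the kinetic-cell scale, in the mean, from the static rarity statement with occupancy
floor, the packed-cell uniform integrability and the kinetic-irregularity input) by the static Cesàro assembly (Option C of the
cycle-4 S5 audit): no predictable projection, no conditional H-theorem, no bin reconstruction. Quantifier bookkeeping only, on
top of the landed pieces

* `lintegral_nonMaxwellian_floor_le` (piece C′, `…CesaroStaticAssemblyFloor.lean`) — the fixed-`N` assembly: pointwise split
  `𝟙{occupied ∧ ϑ < relEnt} ≤ 𝟙{Regular ∧ m₀ ≤ card ∧ ϑ ≤ relEnt} + 𝟙{occupied ∧ Dense} + 𝟙{occupied ∧ ϑh < inhom} +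
  𝟙{occupied ∧ card < m₀}`, the first family transferred from `G_N` to `LG` by the entropy inequality;
* `exists_lgTransferConst` (piece T, `…CesaroTransfer.lean`) — the relative-entropy budget `KL(LG‖G_N) ≤ A(N+1)`;
* `actual_and_nbhd_of_pop_nonempty` (`…ForecastRetyped.lean`) — an occupied cell is an actual kinetic cell with a populated
  neighbourhood, so the integrand of `NoKineticIrregularity` dominates BOTH the occupied-inhomogeneous family (first disjunct)
  and the occupied-under-populated family (second disjunct).

Tolerances: given `δ`, take `δ' := δ/5` and `L := 135 (log 2 + A)/δ` (so `27 (log 2 + A)/L = δ/5`) in `MesoStaticMaxwellRarity`,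
and `δ/5` in `LocalCountUI` (ii) and in `NoKineticIrregularity` (used twice); `σ₀ := min (min σ₁ σ_UI) (min σ_NKI (1/2))`,
`c₀ := max`, `N₀ := max` of the three thresholds and of the mesh threshold `c ℓ_N ≤ 1`.
-/

noncomputable section

open MeasureTheory Set Filter Topology
open scoped ENNReal BigOperators Classical
open Literature.Analysis.FluidPDE Literature.MathematicalPhysics.KineticTheory
open Literature.MathematicalPhysics.KineticTheory.VelocityBlindPlacement

namespace Summit.AtomisticToContinuum.HydrodynamicLimit.Theorems.EquilibriumForecastLine

/-- **Registered stub `stub_cesaroLocalEquilibrium` (S5 of skeleton v5): local equilibrium of the evolved law at the kinetic-cell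
scale, in the mean — `MesoStaticMaxwellRarity → LocalCountUI → NoKineticIrregularity → CoarseLocalMaxwellianity`.** Under the
INVARIANT law `G_N` the unit-fraction of regular, `m₀`-populated, `ϑ`-non-Maxwellian cells exceeds `δ' = δ/5` only with
probability `e^{-L(N+1)}`, `L = 135 (log 2 + A)/δ`; the entropy inequality with `KL(LG‖G_N) ≤ A(N+1)` (piece T) turns this into an
`LG`-mean `≤ δ' + 27 (log 2 + A)/L = 2δ/5`; occupied packed cells (`LocalCountUI` (ii)), occupied `ϑh`-inhomogeneous cells and
occupied cells with fewer than `m₀` spheres (`NoKineticIrregularity`, both disjuncts, on actual cells with populated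
neighbourhood) cost `δ/5` each; the pointwise split of piece C′ (`lintegral_nonMaxwellian_floor_le`) adds them up. [folklore] -/
theorem stub_cesaroLocalEquilibrium : MesoStaticMaxwellRarity → LocalCountUI → NoKineticIrregularity → CoarseLocalMaxwellianity := by
  intro hM hUI hNI a₀ θ₀ u₀ ha hθ hu ha0 hθ0
  obtain ⟨φs, hφs, σ₁, hσ₁, hM⟩ := hM
  obtain ⟨σU, hσU, hUI⟩ := hUI φs hφs a₀ θ₀ u₀ ha hθ hu ha0 hθ0
  obtain ⟨σI, hσI, hNI⟩ := hNI a₀ θ₀ u₀ ha hθ hu ha0 hθ0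
  refine ⟨min (min σ₁ σU) (min σI (1 / 2)), by positivity, fun σ hσ hσlt Φ τ hτ ϑs ϑ δ hϑs hϑ hδ => ?_⟩
  have hσ1 : σ ≤ σ₁ := hσlt.le.trans ((min_le_left _ _).trans (min_le_left _ _))
  have hσU' : σ < σU := hσlt.trans_le ((min_le_left _ _).trans (min_le_right _ _))
  have hσI' : σ < σI := hσlt.trans_le ((min_le_right _ _).trans (min_le_left _ _))
  have hσ2 : σ ≤ 1 / 2 := hσlt.le.trans ((min_le_right _ _).trans (min_le_right _ _))
  -- the transfer constant
  obtain ⟨A, hA, hT⟩ := exists_lgTransferConst ha hθ hu ha0 hθ0 hσ2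
  -- tolerances
  have hl2 : 0 < Real.log 2 := Real.log_pos one_lt_two
  set δ' : ℝ := δ / 5 with hδ'
  set L : ℝ := 5 * 27 * (Real.log 2 + A) / δ with hL
  have hδ'0 : 0 < δ' := by positivity
  have hL0 : 0 < L := by positivity
  have h5 : (0 : ℝ) ≤ δ / 5 := by positivity
  have hLval : 27 * ((Real.log 2 + A) / L) = δ / 5 := by
    rw [hL]
    field_simp
  -- the three inputs
  obtain ⟨m₀, ϑh, hϑh, cM, hcM, hM⟩ := hM σ hσ hσ1 Φ τ hτ ϑs ϑ δ' L hϑs hϑ hδ'0 hL0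
  obtain ⟨-, cU, hcU, hU⟩ := hUI σ hσ hσU' Φ τ hτ (δ / 5) (by positivity)
  obtain ⟨cI, hcI, hI⟩ := hNI σ hσ hσI' Φ τ hτ ϑs ϑh (δ / 5) m₀ hϑs hϑh (by positivity)
  refine ⟨max cM (max cU cI), lt_max_of_lt_left hcM, fun c hc => ?_⟩
  have hcM' : cM ≤ c := (le_max_left _ _).trans hc
  have hcU' : cU ≤ c := ((le_max_left _ _).trans (le_max_right _ _)).trans hc
  have hcI' : cI ≤ c := ((le_max_right _ _).trans (le_max_right _ _)).trans hc
  have hc0 : 0 < c := hcM.trans_le hcM'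
  obtain ⟨NM, hNM⟩ := hM c hcM'
  obtain ⟨NU, hNU⟩ := hU c hcU'
  obtain ⟨NI, hNI⟩ := hI c hcI'
  -- cell size below one eventually
  have hev : ∀ᶠ N : ℕ in atTop, c * meanFreePath σ N ≤ 1 := by
    have ht : Tendsto (fun N : ℕ => c * meanFreePath σ N) atTop (nhds (c * 0)) :=
      (tendsto_meanFreePath hσ).const_mul c
    rw [mul_zero] at ht
    exact ht.eventually (ge_mem_nhds one_pos) |>.mono fun N h => h
  obtain ⟨N1, hN1⟩ := eventually_atTop.1 hev
  refine ⟨max (max NM NU) (max NI N1), fun N hN => ?_⟩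
  have hNM' : NM ≤ N := ((le_max_left _ _).trans (le_max_left _ _)).trans hN
  have hNU' : NU ≤ N := ((le_max_right _ _).trans (le_max_left _ _)).trans hN
  have hNI' : NI ≤ N := ((le_max_left _ _).trans (le_max_right _ _)).trans hN
  have hN1' : N1 ≤ N := ((le_max_right _ _).trans (le_max_right _ _)).trans hN
  have hh0 : 0 < c * meanFreePath σ N := mul_pos hc0 (meanFreePath_pos hσ N)
  have hh1 : c * meanFreePath σ N ≤ 1 := hN1 N hN1'
  obtain ⟨hKL, -, -, -, -⟩ := hT N (Φ N)
  haveI : IsProbabilityMeasure (localGibbsLaw σ a₀ u₀ θ₀ N (Φ N)) :=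
    isProbabilityMeasure_localGibbsLaw ha hθ hu ha0 hθ0 hσ2 N (Φ N)
  haveI : IsProbabilityMeasure (eqLaw σ N (Φ N)) :=
    isProbabilityMeasure_localGibbsLaw (a₀ := fun _ => (1 : ℝ)) (θ₀ := fun _ => (1 : ℝ)) (u₀ := fun _ => (0 : V3))
      continuous_const continuous_const continuous_const (fun _ => one_pos) (fun _ => one_pos) hσ2 N (Φ N)
  -- the kinetic-irregularity input dominates the occupied-inhomogeneous family (first disjunct) …
  have hIle : ∫⁻ z, ENNReal.ofReal (unitAvg c σ N τ fun k q =>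
      if (pop c σ N ((Φ N).flow ((k : ℝ) * stepLen c σ N) z) q).Nonempty ∧
        ϑh < inhom ϑs ((Φ N).flow ((k : ℝ) * stepLen c σ N) z) (pop c σ N ((Φ N).flow ((k : ℝ) * stepLen c σ N) z) q)
          (nbhd c σ N ((Φ N).flow ((k : ℝ) * stepLen c σ N) z) q) then (1 : ℝ) else 0)
      ∂(localGibbsLaw σ a₀ u₀ θ₀ N (Φ N)) ≤ ENNReal.ofReal (δ / 5) := by
    refine (lintegral_mono fun z => ENNReal.ofReal_le_ofReal ?_).trans (hNI N hNI')
    refine unitAvg_mono hh0.le (fun k q hq => indicator_pop_eq_zero_of_not_mem hh0 (Φ N) (fun k q z =>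
        ϑh < inhom ϑs ((Φ N).flow ((k : ℝ) * stepLen c σ N) z) (pop c σ N ((Φ N).flow ((k : ℝ) * stepLen c σ N) z) q)
          (nbhd c σ N ((Φ N).flow ((k : ℝ) * stepLen c σ N) z) q)) z k hq) (fun k q hq => ?_) (fun k q => ?_)
    · rw [if_neg]
      rintro ⟨⟨x, hx⟩, -⟩
      exact hq (hx ▸ cellOf_mem_cellBox hh0 x)
    · by_cases h : (pop c σ N ((Φ N).flow ((k : ℝ) * stepLen c σ N) z) q).Nonempty ∧
          ϑh < inhom ϑs ((Φ N).flow ((k : ℝ) * stepLen c σ N) z) (pop c σ N ((Φ N).flow ((k : ℝ) * stepLen c σ N) z) q)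
            (nbhd c σ N ((Φ N).flow ((k : ℝ) * stepLen c σ N) z) q)
      · rw [if_pos h, if_pos ⟨(actual_and_nbhd_of_pop_nonempty hh0.le _ q h.1).1,
          (actual_and_nbhd_of_pop_nonempty hh0.le _ q h.1).2, Or.inl h.2⟩]
      · rw [if_neg h]
        positivity
  -- … and the occupied-under-populated family (second disjunct)
  have hCle : ∫⁻ z, ENNReal.ofReal (unitAvg c σ N τ fun k q =>
      if (pop c σ N ((Φ N).flow ((k : ℝ) * stepLen c σ N) z) q).Nonempty ∧
        (pop c σ N ((Φ N).flow ((k : ℝ) * stepLen c σ N) z) q).card < m₀ then (1 : ℝ) else 0)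
      ∂(localGibbsLaw σ a₀ u₀ θ₀ N (Φ N)) ≤ ENNReal.ofReal (δ / 5) := by
    refine (lintegral_mono fun z => ENNReal.ofReal_le_ofReal ?_).trans (hNI N hNI')
    refine unitAvg_mono hh0.le (fun k q hq => indicator_pop_eq_zero_of_not_mem hh0 (Φ N) (fun k q z =>
        (pop c σ N ((Φ N).flow ((k : ℝ) * stepLen c σ N) z) q).card < m₀) z k hq) (fun k q hq => ?_) (fun k q => ?_)
    · rw [if_neg]
      rintro ⟨⟨x, hx⟩, -⟩
      exact hq (hx ▸ cellOf_mem_cellBox hh0 x)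
    · by_cases h : (pop c σ N ((Φ N).flow ((k : ℝ) * stepLen c σ N) z) q).Nonempty ∧
          (pop c σ N ((Φ N).flow ((k : ℝ) * stepLen c σ N) z) q).card < m₀
      · rw [if_pos h, if_pos ⟨(actual_and_nbhd_of_pop_nonempty hh0.le _ q h.1).1,
          (actual_and_nbhd_of_pop_nonempty hh0.le _ q h.1).2, Or.inr h⟩]
      · rw [if_neg h]
        positivity
  -- the fixed-`N` assembly with the floor
  have hmain := lintegral_nonMaxwellian_floor_le (Φ N) (localGibbsLaw σ a₀ u₀ θ₀ N (Φ N)) (eqLaw σ N (Φ N)) ϑs ϑh φs m₀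
    (τ := τ) hh0 hh1 hϑ hδ'0.le hA hL0 hKL (hNM N hNM') (hNU N hNU') hIle hCle
  refine hmain.trans ?_
  rw [hLval, ← ENNReal.ofReal_add (add_nonneg hδ'0.le h5) h5,
    ← ENNReal.ofReal_add (add_nonneg (add_nonneg hδ'0.le h5) h5) h5,
    ← ENNReal.ofReal_add (add_nonneg (add_nonneg (add_nonneg hδ'0.le h5) h5) h5) h5]
  refine ENNReal.ofReal_le_ofReal ?_
  rw [hδ']
  linarith

end Summit.AtomisticToContinuum.HydrodynamicLimit.Theorems.EquilibriumForecastLine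

end
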